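import Literature.Topology.FourManifolds.SlideContext
import Literature.Topology.FourManifolds.MorseDiscLemma
import HarnessLib

/-!
# Existence of a slide context about the top critical point of index `1`

Topic `Literature/Topology/FourManifolds` (fact seat
`provefact-Literature.Topology.FourManifolds.lauden-f709dd520c`, Laudenbach–Poénaru's Lemma 2: the
slide of a `1`-handle is performed in Milnor's handle-extension data about its critical point,
`SlideContext.lean`; here that data is produced from the Morse function).  Everything here is
**proved**; no named facts.

**Theorem** (`exists_slideContext`).  Let `M` be a compact manifold with boundary of dimension
`n + 1 ≥ 3`, `f` a Morse function adapted to `∂M`, `p` a critical point with a chart `φ` of the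
maximal atlas in Milnor's normal form of index `1` about `p`, `f = f p - u₁² + u₂² + ⋯` on
`φ.source`, containing the closed chart ball of radius `R₀` about `φ p`; suppose every other
critical point has value `< c₀ < f p` and every level `f⁻¹(c)`, `c₀ < c < f p`, is connected;
let `oM` be an orientation and `ε_max > 0`.  Then there is a slide context `C` on `M`
(`SlideContext n M`) with `C.S.f = f`, `C.S.p = p`, box size `C.S.ε ≤ ε_max`, seed band above
`c₀` (`c₀ < C.c - 5 C.τ`), whose handle chart has the coordinates of `φ` on the chart ball of
radius `4ε`.  Proof: choose `ε` so small that `5ε ≤ R₀`, `ε ≤ 1/4`, `27 ε² ≤ f p - c₀`,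
`18 ε² ≤ 1 - f p`, put `τ = ε²/100`, `η = τ/9`, `c = f p - 25ε² - 8τ`, `r = ε/10`, `γ = 32r⁴`,
`a = f p - ε²/2`, `ℓ⁺ = f p + ε²`, `δ = ε²/100`, `ℓ₁ = c - 4τ`, `ℓ₂ = f p + 16ε²`, and apply
`exists_handleSide_data` (`HandleSideConstruction.lean`) with no prescribed germ.

## References

* J. Milnor, *Lectures on the h-cobordism theorem* (1965), Def. 3.1, Lemma 3.2, proofs of
  Thm. 3.4 and Thm. 3.13. [MilnorHCobordism1965]
-/

open scoped Manifold ContDiff Topology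
open Set Function Filter Metric Module

noncomputable section

namespace Literature.Topology.FourManifolds

universe u

variable {n : ℕ} {M : Type u} [TopologicalSpace M] [T2Space M] [CompactSpace M]
  [ChartedSpace (EuclideanHalfSpace (n + 1)) M] [IsManifold (𝓡∂ (n + 1)) ∞ M]

set_option maxHeartbeats 1600000 in
/-- **Existence of a slide context about the top critical point** (see the module docstring).
[cite: MilnorHCobordism1965, Def. 3.1, Lemma 3.2 and proofs of Thms. 3.4, 3.13] -/
theorem exists_slideContext (hn : 2 ≤ n) {f : M → ℝ} (hF : IsMorseAdapted (𝓡∂ (n + 1)) f)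
    {p : M} (hp : IsMCriticalPt (𝓡∂ (n + 1)) f p)
    {φ : OpenPartialHomeomorph M (EuclideanHalfSpace (n + 1))}
    (hφ : φ ∈ IsManifold.maximalAtlas (𝓡∂ (n + 1)) ∞ M) (hpφ : p ∈ φ.source)
    (hfq : ∀ q ∈ φ.source, f q = f p +
      milnorQuadratic 1 (φ.extend (𝓡∂ (n + 1)) q - φ.extend (𝓡∂ (n + 1)) p))
    {R₀ : ℝ} (hR₀ : 0 < R₀) (hR : closedBall (φ.extend (𝓡∂ (n + 1)) p) R₀ ⊆ (φ.extend (𝓡∂ (n + 1))).target)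
    {c₀ : ℝ} (hc₀ : c₀ < f p) (hcrit : ∀ x, IsMCriticalPt (𝓡∂ (n + 1)) f x → x ≠ p → f x < c₀)
    (hconn : ∀ c, c₀ < c → c < f p → IsConnected (f ⁻¹' {c}))
    (oM : SmoothOrientation (𝓡∂ (n + 1)) M) {εmax : ℝ} (hεmax : 0 < εmax) :
    ∃ C : SlideContext n M, C.S.f = f ∧ C.S.p = p ∧ C.S.ε ≤ εmax ∧ c₀ < C.c - 5 * C.τ ∧
      (∀ q, C.S.D.chart.extend (𝓡∂ (n + 1)) q = φ.extend (𝓡∂ (n + 1)) q) ∧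
      C.S.D.chart.source = φ.source ∩ φ.extend (𝓡∂ (n + 1)) ⁻¹' ball (φ.extend (𝓡∂ (n + 1)) p) (4 * C.S.ε) := by
  have hfs : ContMDiff (𝓡∂ (n + 1)) 𝓘(ℝ, ℝ) ∞ f := hF.1.contMDiff
  have hp1 : f p < 1 := hF.2.2 p (hF.isInteriorPoint_of_isMCriticalPt hp)
  -- the box size
  set d : ℝ := min ((f p - c₀) / 27) ((1 - f p) / 18) with hd
  have hdpos : 0 < d := lt_min (by linarith) (by linarith)
  set ε : ℝ := min (min εmax (R₀ / 5)) (min (1 / 4 : ℝ) d) with hε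
  have hεpos : 0 < ε := lt_min (lt_min hεmax (by linarith)) (lt_min (by norm_num) hdpos)
  have hεmax' : ε ≤ εmax := (min_le_left _ _).trans (min_le_left _ _)
  have hεR : 5 * ε ≤ R₀ := by
    have : ε ≤ R₀ / 5 := (min_le_left _ _).trans (min_le_right _ _)
    linarith
  have hε4 : ε ≤ 1 / 4 := (min_le_right _ _).trans (min_le_left _ _)
  have hεd : ε ≤ d := (min_le_right _ _).trans (min_le_right _ _)
  have hε2 : ε ^ 2 ≤ d := by nlinarith
  have hd1 : d ≤ (f p - c₀) / 27 := min_le_left _ _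
  have hd2 : d ≤ (1 - f p) / 18 := min_le_right _ _
  have hε27 : 27 * ε ^ 2 ≤ f p - c₀ := by linarith
  have hε18 : 18 * ε ^ 2 ≤ 1 - f p := by linarith
  -- the other constants
  set τ : ℝ := ε ^ 2 / 100 with hτ
  set η : ℝ := τ / 9 with hη
  set c : ℝ := f p - 25 * ε ^ 2 - 8 * τ with hc
  set r : ℝ := ε / 10 with hr
  set γ : ℝ := 32 * r ^ 4 with hγ
  set a : ℝ := f p - ε ^ 2 / 2 with ha
  set ℓu : ℝ := f p + ε ^ 2 with hℓu
  set δ : ℝ := ε ^ 2 / 100 with hδ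
  set ℓ₁ : ℝ := c - 4 * τ with hℓ₁
  set ℓ₂ : ℝ := f p + 16 * ε ^ 2 with hℓ₂
  set ℓ₀ : ℝ := c - 5 * τ with hℓ₀
  set ℓ₃ : ℝ := f p + 17 * ε ^ 2 with hℓ₃
  have hε2pos : 0 < ε ^ 2 := by positivity
  have hτpos : 0 < τ := by positivity
  have hηpos : 0 < η := by positivity
  have hrpos : 0 < r := by positivity
  have hγr : γ = 32 * (ε / 10) ^ 4 := rfl
  have hγε : γ / ε ^ 2 = 32 / 10 ^ 4 * ε ^ 2 := by rw [div_eq_iff hε2pos.ne', hγr]; ring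
  have hγε' : γ / (4 * ε ^ 2) = 8 / 10 ^ 4 * ε ^ 2 := by rw [div_eq_iff (by positivity), hγr]; ring
  -- the data of the handle side
  obtain ⟨X, θ, D, hXint, hflow, hDk, hDr, hDe, hDs, hball, -, hunit, hspeed, hc1, hc2, hc3, hcore, hcorelt⟩ :=
    exists_handleSide_data (n := n) hfs (ℓ₀ := ℓ₀) (ℓ₁ := ℓ₁) (ℓ₂ := ℓ₂) (ℓ₃ := ℓ₃)
      (by show c - 5 * τ < c - 4 * τ; linarith) (by show f p + 16 * ε ^ 2 < f p + 17 * ε ^ 2; linarith)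
      (fun x hx => by rw [(hF.2.1 x hx).1]; show f p + 17 * ε ^ 2 < 1; linarith)
      hφ hpφ (k := 1) hfq (ε := ε) (r := r) (γ := γ) (η := η) (a := a) (ℓu := ℓu) (δ := δ)
      hεpos hrpos (by rw [hr]; nlinarith) (by rw [hr]; linarith) le_rfl hηpos (by positivity)
      ((closedBall_subset_closedBall hεR).trans hR)
      (by show c - 4 * τ ≤ f p - 16 * ε ^ 2; linarith) le_rfl
      (fun x hx hxp hzero => by
        have hxc : IsMCriticalPt (𝓡∂ (n + 1)) f x := hzero
        have := hcrit x hxc hxp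
        have : c - 5 * τ ≤ f x := hx.1
        linarith)
      (by show f p - ε ^ 2 + γ / ε ^ 2 < a - η / 4; rw [hγε, ha, hη, hτ]; nlinarith)
      (by show a - η / 4 ≤ f p - 4 * r ^ 2; rw [ha, hη, hτ, hr]; nlinarith)
      (by show f p + 4 * r ^ 2 ≤ ℓu - δ; rw [hℓu, hδ, hr]; nlinarith)
      (by show ℓu < f p + 4 * ε ^ 2 - γ / (4 * ε ^ 2); rw [hγε', hℓu]; nlinarith)
      (K₂ := ∅) (U₂ := ∅) isClosed_empty isOpen_empty (empty_subset _) (fun x hx => hx.elim)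
      (Set.empty_disjoint _) (ξ₂ := fun _ => 0) (fun x hx => hx.elim) (fun x hx => hx.elim)
  -- the handle side
  let S : HandleSide (𝓡∂ (n + 1)) M :=
    { f := f, X := X, θ := θ, p := p, D := D, hf := hfs, hX := hXint.contMDiff, flow := hflow
      ε := ε, γ := γ, η := η, a := a, ℓ₁ := ℓ₁, ℓ₂ := ℓ₂, ℓu := ℓu, δ := δ
      ε_pos := hεpos, γ_pos := by positivity, η_pos := hηpos, δ_pos := by positivity
      hball := hball, hunit := hunit, hspeed := hspeed
      isClosed_region := hc1, isClosed_region_half := hc2, isClosed_region_small := hc3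
      core_subset := hcore, lt_of_mem_core := hcorelt
      hlow := by show f p - ε ^ 2 + γ / ε ^ 2 < a - η / 4; rw [hγε, ha, hη, hτ]; nlinarith
      hhigh := by show ℓu < f p + 4 * ε ^ 2 - γ / (4 * ε ^ 2); rw [hγε', hℓu]; nlinarith
      hℓ₁ := by show c - 4 * τ < a - (ℓu - a) - η; rw [hc, ha, hℓu, hη, hτ]; nlinarith
      ha := by show a + η < ℓu - δ; rw [ha, hℓu, hδ, hη, hτ]; nlinarith
      hℓu := by show f p + ε ^ 2 < f p + 16 * ε ^ 2; nlinarith }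
  refine ⟨⟨S, hn, hF, c, τ, hτpos, hDk, ?_, ?_, rfl, rfl, rfl, rfl, rfl, hε4, le_rfl, ?_, ?_, ?_, ?_, ?_, ?_, oM⟩,
    rfl, rfl, hεmax', ?_, hDe, hDs⟩
  · show D.r = ε / 10; rw [hDr]
  · show γ = 32 * D.r ^ 4; rw [hDr]
  · show η ≤ ε ^ 2 / 100; rw [hη, hτ]; nlinarith
  · show 9 * η ≤ τ; rw [hη]; linarith
  · show c + 8 * τ ≤ f p - 25 * ε ^ 2; rw [hc]; linarith
  · show f p + 17 * ε ^ 2 < 1; linarith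
  · intro x hx hxp hxc
    have := hcrit x hxc hxp
    have hx' : c - 5 * τ ≤ f x := hx
    linarith
  · exact hconn c (by rw [hc, hτ]; nlinarith) (by rw [hc]; linarith)
  · show c₀ < c - 5 * τ
    rw [hc, hτ]; nlinarith

end Literature.Topology.FourManifolds
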